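import Summits.QuantumAdvantage.QuantumAdvantage.Theses.SpikesNeedAddresses
import Summits.QuantumAdvantage.QuantumAdvantage.Theorems.RandomOracleGaugePromiseTransfer
import HarnessLib

/-!
# Route `SpikesNeedAddresses`, crux `PromiseTransfer` (stmt-QuantumAdvantage-11702) — PROVED, from the sibling crux `TransferPB`

The crux `Summit.QuantumAdvantage.QuantumAdvantage.Theses.SpikesNeedAddresses.PromiseTransfer` (the same promise transfer as
route `RandomOracleGauge`'s stmt-QuantumAdvantage-10749, spelled with the cube notions and the average-case class written inline)
BY NAME: the sibling crux `TransferPB` of route `SosSandwich` (`Theorems/SosSandwichTransferPB.lean`) fed with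
`pseudoBoundedAA_of_aaConj` (`Theorems/RandomOracleGaugePromiseTransfer.lean`: the Aaronson–Ambainis conjecture implies PB-AA);
the inline spelling unfolds reducibly to the tree notions. No named fact; axioms standard.
Source: S. Aaronson, A. Ambainis, Theory Comput. 10 (2014), Thm. 7(iii), Thm. 23.
-/

-- D-0017: single-conjunct summit ⇒ the duplicate `QuantumAdvantage.QuantumAdvantage` is mandated.
set_option linter.dupNamespace false

noncomputable section

namespace Summit.QuantumAdvantage.QuantumAdvantage.Theorems.SpikesNeedAddresses

/-- **Crux `PromiseTransfer` of route `SpikesNeedAddresses` (stmt-QuantumAdvantage-11702), BY NAME**: granted the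
Aaronson–Ambainis conjecture, if `PromiseBQP ⊆ PromiseBPP'` then `BQP^A ⊆ AvgP^A` for almost every random oracle `A`.
[cite: AaronsonAmbainis2014, Thm. 7(iii) and Thm. 23] -/
theorem PromiseTransfer_proof : Summit.QuantumAdvantage.QuantumAdvantage.Theses.SpikesNeedAddresses.PromiseTransfer :=
  fun hAA hPr => Summit.QuantumAdvantage.QuantumAdvantage.Theorems.SosSandwich.TransferPB_proof
    (Summit.QuantumAdvantage.QuantumAdvantage.Theorems.RandomOracleGauge.pseudoBoundedAA_of_aaConj hAA) hPr

end Summit.QuantumAdvantage.QuantumAdvantage.Theorems.SpikesNeedAddresses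

end
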